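import Summits.MatrixMultiplication.OmegaCensus.SmallFormats.MatMul22nLoadedPlaneStructure
import HarnessLib

/-!
# ω-census family (a): the 4-term sub-computation of a loaded COLUMN plane — every term sees the cheap inputs, and a DOUBLE cell sees them twice (any field)

Cell `pub-omega` (unit `pub-omega-tensor`, gen 40), topic `Summits/MatrixMultiplication/OmegaCensus` (sub-folder
`SmallFormats`). Framing (verbatim): lottery ticket; floor = certified bounds/negative ranges. HONEST FRAMING: §7(a) of tensor g40's memo
DEFLATION-g40, any field, elementary. For a column plane (X-forms `U` with `U ν' = 0`... here: the four terms `S` whose X-forms kill the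
vector `mu`) with cheap input vectors `b 0, b 1` (`loadedColPlane_structure`: every term OUTSIDE `S` has `g_t(ν bᵀ) = 0`, `ν = (−mu₁, mu₀)`),
Brent restricted to the inputs `Y = ν (b m)ᵀ` is a 4-term computation of `(X, b') ↦ (Xν) b'ᵀ`, whose values span the 4-dimensional
`k² ⊗ span(b)`; hence (`ColumnSubcomp.sees_cheap_input`) EVERY term of `S` has `g_s(ν (b m)ᵀ) ≠ 0` for some `m`, and
(`ColumnSubcomp.double_cell_independent`) two terms of `S` with the SAME X-form have linearly independent pairs
`(g_s(ν (b 0)ᵀ), g_s(ν (b 1)ᵀ))` — the «double cell ⇒ invertible Gram block» input of the M2 kill. Nothing here is a bound on `ω`.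
-/

namespace Summit.MatrixMultiplication.OmegaCensus.SmallFormats

open Finset Module Matrix
open Literature.Computability.AlgebraicComplexity
open Summit.MatrixMultiplication.OmegaCensus.RankOnePlaneCapGeneral

namespace ColumnSubcomp

variable {k : Type*} [Field k] {n : ℕ} {ι : Type*} [Fintype ι]

omit [Fintype ι] in
/-- Four into three does not go: if `b 0, b 1 ∈ kⁿ` are linearly independent, the four rank-one matrices `e_p (b m)ᵀ` do not all lie in the
span of three matrices. -/
theorem not_all_vecMulVec_mem_span_three (b : Fin 2 → (Fin n → k)) (hind : ∀ a : Fin 2 → k, ∑ m, a m • b m = 0 → ∀ m, a m = 0)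
    (w : Fin 3 → Matrix (Fin 2) (Fin n) k)
    (hmem : ∀ (z : Fin 2 → k) (m : Fin 2), Matrix.vecMulVec z (b m) ∈ Submodule.span k (Set.range w)) : False := by
  classical
  let W : Submodule k (Matrix (Fin 2) (Fin n) k) := Submodule.span k (Set.range w)
  have hW : finrank k W ≤ 3 := by
    calc finrank k W ≤ (Finset.univ.image w).card := by
          rw [show W = Submodule.span k ((Finset.univ.image w : Finset _) : Set _) by simp [W]]
          exact finrank_span_finset_le_card _
      _ ≤ Fintype.card (Fin 3) := Finset.card_image_le.trans (by simp)
      _ = 3 := Fintype.card_fin 3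
  -- the family (p, m) ↦ e_p (b m)ᵀ inside W
  let v : Fin 2 × Fin 2 → W := fun pm => ⟨Matrix.vecMulVec (Pi.single pm.1 1) (b pm.2), hmem _ _⟩
  have hv : LinearIndependent k v := by
    rw [Fintype.linearIndependent_iff]
    intro a ha pm
    -- read off entry (p, ·) of the relation: ∑_m a (p,m) • b m = 0
    have hsum : (∑ q, a q • (v q : Matrix (Fin 2) (Fin n) k)) = 0 := by
      have := congrArg (fun x : W => (x : Matrix (Fin 2) (Fin n) k)) ha
      simpa using this
    have hentry : ∀ (p : Fin 2) (j : Fin n), (∑ q, a q • (v q : Matrix (Fin 2) (Fin n) k)) p j = ∑ m, a (p, m) * b m j := by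
      intro p j
      rw [Matrix.sum_apply]
      simp only [Matrix.smul_apply, smul_eq_mul, v, Matrix.vecMulVec_apply, Pi.single_apply]
      rw [Fintype.sum_prod_type, Finset.sum_eq_single p]
      · simp
      · intro x _ hx
        simp [Ne.symm hx]
      · intro hp; exact absurd (Finset.mem_univ p) hp
    have hrow : ∀ p : Fin 2, ∑ m, a (p, m) • b m = 0 := by
      intro p
      funext j
      have h := congrFun (congrFun hsum p) j
      rw [hentry, Matrix.zero_apply] at h
      simpa [Finset.sum_apply, Pi.smul_apply, smul_eq_mul] using h
    exact hind (fun m => a (pm.1, m)) (hrow pm.1) pm.2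
  have h4 : Fintype.card (Fin 2 × Fin 2) ≤ finrank k W := hv.fintype_card_le_finrank
  simp at h4
  omega

/-- **The column sub-computation.** If the terms outside `S` do not see the inputs `ν (b m)ᵀ`, then Brent restricted to them reads
`∑_{s ∈ S} f_s(X) g_s(ν (b m)ᵀ) w_s = (X ν)(b m)ᵀ`. -/
theorem subcomp_identity (β : BilinComp (mulBilin k 2 2 n) ι) (nu : Fin 2 → k) (S : Finset ι) (b : Fin 2 → (Fin n → k))
    (hcheap : ∀ t, t ∉ S → ∀ m, β.g t (Matrix.vecMulVec nu (b m)) = 0) (X : Matrix (Fin 2) (Fin 2) k) (m : Fin 2) :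
    ∑ s ∈ S, (β.f s X * β.g s (Matrix.vecMulVec nu (b m))) • β.w s = Matrix.vecMulVec (X.mulVec nu) (b m) := by
  classical
  have h := β.map_eq_sum X (Matrix.vecMulVec nu (b m))
  rw [mulBilin_apply] at h
  have hXY : X * Matrix.vecMulVec nu (b m) = Matrix.vecMulVec (X.mulVec nu) (b m) := by
    ext p j
    simp only [Matrix.mul_apply, Matrix.vecMulVec_apply, Matrix.mulVec, dotProduct, Finset.sum_mul, mul_assoc]
  rw [← hXY, h, ← Finset.sum_subset (Finset.subset_univ S)]
  intro t _ ht
  rw [hcheap t ht m, mul_zero, zero_smul]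

/-- **Every term of a loaded column plane sees the cheap inputs** (`(R-adm)` of the memo): with `|S| = 4`, `ν ≠ 0`, `b` independent and
the terms outside `S` blind to `ν (b m)ᵀ`, each `s ∈ S` has `g_s(ν (b m)ᵀ) ≠ 0` for some `m`. -/
theorem sees_cheap_input (β : BilinComp (mulBilin k 2 2 n) ι) (nu : Fin 2 → k) (hnu : nu ≠ 0) (S : Finset ι) (hS4 : S.card = 4)
    (b : Fin 2 → (Fin n → k)) (hind : ∀ a : Fin 2 → k, ∑ m, a m • b m = 0 → ∀ m, a m = 0)
    (hcheap : ∀ t, t ∉ S → ∀ m, β.g t (Matrix.vecMulVec nu (b m)) = 0) (s₀ : ι) (hs₀ : s₀ ∈ S) :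
    ∃ m, β.g s₀ (Matrix.vecMulVec nu (b m)) ≠ 0 := by
  classical
  by_contra hno
  push Not at hno
  -- the other three terms
  have hcard : (S.erase s₀).card = 3 := by rw [Finset.card_erase_of_mem hs₀, hS4]
  let e : Fin 3 ≃ (S.erase s₀) := (Fintype.equivFinOfCardEq (by rw [Fintype.card_coe, hcard])).symm
  let w : Fin 3 → Matrix (Fin 2) (Fin n) k := fun i => β.w (e i).1
  refine not_all_vecMulVec_mem_span_three b hind w fun z m => ?_
  -- choose X with X ν = z
  obtain ⟨X, hX⟩ : ∃ X : Matrix (Fin 2) (Fin 2) k, X.mulVec nu = z := by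
    obtain ⟨q, hq⟩ : ∃ q, nu q ≠ 0 := by
      by_contra h; push Not at h; exact hnu (funext h)
    refine ⟨Matrix.of fun p q' => if q' = q then z p / nu q else 0, ?_⟩
    funext p
    simp only [Matrix.mulVec, dotProduct, Matrix.of_apply]
    rw [Finset.sum_eq_single q]
    · simp [div_mul_cancel₀ _ hq]
    · intro q' _ hq'; simp [hq']
    · intro h; exact absurd (Finset.mem_univ q) h
  have hid := subcomp_identity β nu S b hcheap X m
  rw [hX] at hid
  rw [← hid, ← Finset.add_sum_erase S _ hs₀, hno m, mul_zero, zero_smul, zero_add]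
  refine Submodule.sum_mem _ fun t ht => Submodule.smul_mem _ _ (Submodule.subset_span ⟨e.symm ⟨t, ht⟩, ?_⟩)
  simp [w]

/-- **A double cell sees the cheap inputs twice**: two distinct terms `s₁, s₂ ∈ S` with the same X-form have linearly independent pairs
`(g_{s_i}(ν (b 0)ᵀ), g_{s_i}(ν (b 1)ᵀ))`, i.e. no non-trivial combination `a₁ g_{s₁} + a₂ g_{s₂}` vanishes on both cheap inputs. -/
theorem double_cell_independent (β : BilinComp (mulBilin k 2 2 n) ι) (nu : Fin 2 → k) (hnu : nu ≠ 0) (S : Finset ι)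
    (hS4 : S.card = 4) (b : Fin 2 → (Fin n → k)) (hind : ∀ a : Fin 2 → k, ∑ m, a m • b m = 0 → ∀ m, a m = 0)
    (hcheap : ∀ t, t ∉ S → ∀ m, β.g t (Matrix.vecMulVec nu (b m)) = 0) (s₁ s₂ : ι) (hs₁ : s₁ ∈ S) (hs₂ : s₂ ∈ S) (hne : s₁ ≠ s₂)
    (hf : β.f s₁ = β.f s₂) (a₁ a₂ : k)
    (hrel : ∀ m, a₁ * β.g s₁ (Matrix.vecMulVec nu (b m)) + a₂ * β.g s₂ (Matrix.vecMulVec nu (b m)) = 0) : a₁ = 0 ∧ a₂ = 0 := by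
  classical
  -- WLOG a₂ ≠ 0 (else a₁ g_{s₁} = 0 on the cheap inputs, and `sees_cheap_input` gives a₁ = 0)
  by_cases ha₂ : a₂ = 0
  · subst ha₂
    by_cases ha₁ : a₁ = 0
    · exact ⟨ha₁, rfl⟩
    · exfalso
      obtain ⟨m, hm⟩ := sees_cheap_input β nu hnu S hS4 b hind hcheap s₁ hs₁
      have := hrel m
      rw [zero_mul, add_zero] at this
      exact hm ((mul_eq_zero.mp this).resolve_left ha₁)
  exfalso
  -- g_{s₂} = -(a₁/a₂) g_{s₁} on the cheap inputs: the two terms merge into one, three w's span everything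
  set c : k := -(a₁ / a₂) with hc
  have hg₂ : ∀ m, β.g s₂ (Matrix.vecMulVec nu (b m)) = c * β.g s₁ (Matrix.vecMulVec nu (b m)) := by
    intro m
    have h := hrel m
    rw [hc]
    field_simp
    linear_combination h
  have hs₂' : s₂ ∈ S.erase s₁ := Finset.mem_erase.mpr ⟨hne.symm, hs₂⟩
  have hcard : ((S.erase s₁).erase s₂).card = 2 := by
    rw [Finset.card_erase_of_mem hs₂', Finset.card_erase_of_mem hs₁, hS4]
  let e : Fin 2 ≃ ((S.erase s₁).erase s₂) := (Fintype.equivFinOfCardEq (by rw [Fintype.card_coe, hcard])).symm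
  let w : Fin 3 → Matrix (Fin 2) (Fin n) k :=
    fun i => if h : (i : ℕ) < 2 then β.w (e ⟨i, h⟩).1 else β.w s₁ + c • β.w s₂
  refine not_all_vecMulVec_mem_span_three b hind w fun z m => ?_
  obtain ⟨X, hX⟩ : ∃ X : Matrix (Fin 2) (Fin 2) k, X.mulVec nu = z := by
    obtain ⟨q, hq⟩ : ∃ q, nu q ≠ 0 := by
      by_contra h; push Not at h; exact hnu (funext h)
    refine ⟨Matrix.of fun p q' => if q' = q then z p / nu q else 0, ?_⟩
    funext p
    simp only [Matrix.mulVec, dotProduct, Matrix.of_apply]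
    rw [Finset.sum_eq_single q]
    · simp [div_mul_cancel₀ _ hq]
    · intro q' _ hq'; simp [hq']
    · intro h; exact absurd (Finset.mem_univ q) h
  have hid := subcomp_identity β nu S b hcheap X m
  rw [hX] at hid
  rw [← hid, ← Finset.add_sum_erase S _ hs₁, ← Finset.add_sum_erase _ _ hs₂', hg₂ m, ← hf, ← add_assoc]
  have hmerge : (β.f s₁ X * β.g s₁ (vecMulVec nu (b m))) • β.w s₁ +
      (β.f s₁ X * (c * β.g s₁ (vecMulVec nu (b m)))) • β.w s₂ =
      (β.f s₁ X * β.g s₁ (vecMulVec nu (b m))) • (β.w s₁ + c • β.w s₂) := by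
    rw [smul_add, smul_smul]; ring_nf
  rw [hmerge]
  refine Submodule.add_mem _ (Submodule.smul_mem _ _ (Submodule.subset_span ⟨⟨2, by norm_num⟩, by simp [w]⟩)) ?_
  refine Submodule.sum_mem _ fun t ht => Submodule.smul_mem _ _ (Submodule.subset_span ⟨⟨(e.symm ⟨t, ht⟩ : ℕ), by omega⟩, ?_⟩)
  have hlt : ((e.symm ⟨t, ht⟩ : Fin 2) : ℕ) < 2 := (e.symm ⟨t, ht⟩).2
  simp only [w, hlt, dif_pos, Fin.eta, Equiv.apply_symm_apply]

end ColumnSubcomp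

end Summit.MatrixMultiplication.OmegaCensus.SmallFormats
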